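import Summits.ResolutionOfSingularities.ResolutionOfSingularities.Theorems.FrobeniusClosingSteerToricUnitExitStep
import HarnessLib

/-!
# Crux `Steer` (stmt-ResolutionOfSingularities-16345) — K-TX, part 2a: the K-TX STEP RELATION `KRel` (local blowing up + frame + exponent bookkeeping)

OURS (campaign res-hironaka, rung L ★L-G4, slot W4.1; res-D-brk-2 g6 on res-L0-w41-plan-1 RULING 257 (a)(2), retype 258 (c)). Candidates,
not facts; NOT a statement of H. Hironaka's manuscript [claim: Hironaka2017, status: under-review]; AI formalisation, weaker than expert
review; `--supports stmt-ResolutionOfSingularities-16345`, counted 0.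

## What is proved

`KRel O R z R' z' T` (`§1`): `R'` is a local blowing up of `R` w.r.t. `O` (`IsLocalBlowup`), `(R', z')` is a K-TX frame (part 1), and the
exponent transformer `T` re-expresses every Laurent monomial (`z' ^ (T f) = z ^ f`), commutes with negation, preserves `ℕ`-vectors and odd
coordinates. It is reflexive on frames, transitive (`IsLocalBlowup.trans`), and ONE pair step in the orientation the valuation dictates
produces it (part 1b `frame_step`). The exponent game of `…SteerToricVertexPerron` (its private bookkeeping is repeated in `§2`) then
gives, with the SAME induction texts:
* `exists_krel_uniform` / `exists_krel_nonneg` / `exists_krel_nonneg_family` (`§3`) — Perron monomialisation of finitely many Laurent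
  monomials of positive value, now through regular local stages reached by local blowings up;
* `exists_krel_single_odd` (`§4`) — reduction of the odd support of an `ℕ`-vector to one letter.
[cite: Teissier2014] [cite: NovacoskiSpivakovsky2014, Def. 2.11] [cite: DeJong1996, 2.4] [folklore]
-/

noncomputable section

-- single-problem summit: the doubled namespace component `ResolutionOfSingularities` is forced
set_option linter.dupNamespace false

open scoped BigOperators

namespace Summit.ResolutionOfSingularities.ResolutionOfSingularities.Theorems.SteerToricUnitExit

open IsLocalRing
open Literature.AlgebraicGeometry.Resolution
open Summit.ResolutionOfSingularities.ResolutionOfSingularities.Theorems.SteerToricVertexSplit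

variable {K : Type} [Field K]

/-! ## §1 The K-TX step relation -/

section KRel

variable {n : ℕ}

/-- Letters of a frame lie in `O`. [folklore] -/
theorem Frame.mem_O {O : ValuationSubring K} {R : Subring K} {z : Fin n → K} (hF : Frame O R z) (j : Fin n) : z j ∈ O := by
  obtain ⟨-, hRO, -, -, -, hz, -⟩ := hF
  exact hRO (hz j)

/-- Letters of a frame are non-zero. [folklore] -/
theorem Frame.ne_zero {O : ValuationSubring K} {R : Subring K} {z : Fin n → K} (hF : Frame O R z) (j : Fin n) : z j ≠ 0 := by
  obtain ⟨-, -, -, -, hz0, -⟩ := hF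
  exact hz0 j

/-- **The K-TX step relation**: a local blowing up to a frame, with an exponent transformer re-expressing all Laurent monomials,
commuting with negation and preserving `ℕ`-vectors and odd coordinates. OURS bookkeeping. [folklore] -/
def KRel (O : ValuationSubring K) (R : Subring K) (z : Fin n → K) (R' : Subring K) (z' : Fin n → K)
    (T : (Fin n → ℤ) → (Fin n → ℤ)) : Prop :=
  IsLocalBlowup O R R' ∧ Frame O R' z' ∧ (∀ f, (∏ j, z' j ^ T f j) = ∏ j, z j ^ f j) ∧ (∀ f, T (-f) = -T f) ∧
    (∀ f : Fin n → ℤ, (∀ j, 0 ≤ f j) → ∀ j, 0 ≤ T f j) ∧ (∀ f : Fin n → ℤ, (∃ j, Odd (f j)) → ∃ j, Odd (T f j))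

/-- Reflexivity on frames (the identity local blowing up). [folklore] -/
theorem krel_refl (O : ValuationSubring K) (R : Subring K) (z : Fin n → K) (hF : Frame O R z) : KRel O R z R z id := by
  obtain ⟨hreg, hRO, hRloc, hrest⟩ := hF
  refine ⟨⟨hRO, ∅, by simp, by rw [Finset.coe_empty, Set.union_empty, Subring.closure_eq, hRloc]⟩, ⟨hreg, hRO, hRloc, hrest⟩,
    fun _ => rfl, fun _ => rfl, fun _ h => h, fun _ h => h⟩

/-- Transitivity (local blowings up compose; transformers compose). [cite: NovacoskiSpivakovsky2014, Lemma 2.9] -/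
theorem krel_trans (O : ValuationSubring K) {R R' R'' : Subring K} {z z' z'' : Fin n → K} {T T' : (Fin n → ℤ) → (Fin n → ℤ)}
    (h : KRel O R z R' z' T) (h' : KRel O R' z' R'' z'' T') : KRel O R z R'' z'' (T' ∘ T) := by
  obtain ⟨h1, -, h4, h5, h6, h7⟩ := h
  obtain ⟨h1', h2', h4', h5', h6', h7'⟩ := h'
  refine ⟨h1.trans h1', h2', fun f => ?_, fun f => ?_, fun f hf => h6' _ (h6 f hf), fun f hf => h7' _ (h7 f hf)⟩
  · rw [Function.comp_apply, h4', h4]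
  · rw [Function.comp_apply, Function.comp_apply, h5, h5']

/-- **One step in the orientation the valuation dictates** (part 1b `frame_step` dressed with the exponent bookkeeping of
`…SteerToricVertexSplit`). [cite: DeJong1996, 2.4] [folklore] -/
theorem krel_step (O : ValuationSubring K) (R : Subring K) (z : Fin n → K) (hF : Frame O R z) {a b : Fin n} (hab : a ≠ b) :
    (∃ R' z', KRel O R z R' z' (fun f => Function.update f a (f a + f b))) ∨
      (∃ R' z', KRel O R z R' z' (fun f => Function.update f b (f b + f a))) := by
  have hz0 := hF.ne_zero
  rcases frame_step O R z hF hab with ⟨R', hbl, hF'⟩ | ⟨R', hbl, hF'⟩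
  · exact Or.inl ⟨R', _, hbl, hF', prod_zpow_update_shift z hz0 hab, shift_neg a b, fun f hf => shift_nonneg a b hf,
      fun f hf => shift_odd hab hf⟩
  · exact Or.inr ⟨R', _, hbl, hF', prod_zpow_update_shift z hz0 hab.symm, shift_neg b a, fun f hf => shift_nonneg b a hf,
      fun f hf => shift_odd hab.symm hf⟩

end KRel


end Summit.ResolutionOfSingularities.ResolutionOfSingularities.Theorems.SteerToricUnitExit

end
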